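import Summits.CriticalPhenomena.PercolationContinuityZ3.Theorems.Transplant.FKConnectivityAllQAntipodalOrAttSides
import HarnessLib

/-!
# Connectivity correlation inequalities for `φ_{w,q}`, every `q > 0` — file 47c: the OR-ATTACHED drift `O(N; y, z; C)` across a SERIES junction
# with `y, z` on ONE side (towards the `q`-free level-3 inequality for the type `x ∧ (y ∨ z)`, Conjecture `C_∞⁺` of gen 21)

Support file (`--supports stmt-CriticalPhenomena-4575`), FK sub-lane `prim-bschramm-fk-2` (gen 22); builds on p205010 (kernel theorem,
internal audit signed; external expert review pending).  No definitions, no named facts, no sorries; standard axioms.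

Companion of `…OrAttSeries` (the separating junction).  Here `y, z` lie on one side of the series junction `E = E₁(s,m) · E₂(m,t)`: after the
three-fold application of `FK.andGenW_series_eq`, that side carries the three drifts of `O` with the VIRTUAL root (`sm` or `mt`) — the induction
hypothesis of `…OrAttPath` — and, without root, the AND-contracted drift `(yzCᵢ | Cᵢ)` plus a cancelling pair (`FK.twoSidedW_swap`); the other
side carries its U-drift `(Cⱼ | Cⱼ)` with `0/1` coefficients and shifted antitone weights (the rootless companion vanishes identically,
`FK.andGenW_rootless_self`).  `FK.orAttW_series_same₁_nonpos` (side 1), `FK.orAttW_series_same₂_nonpos` (side 2).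
[cite: Grimmett2006, §1.4 eq. (1.20) (p. 15); §3.8 Thm. (3.90) (pp. 61–62); §3.9 (pp. 63–64)] [cite: Wagner2006, Thm. 5.8(d), §5.3]
-/

noncomputable section

namespace Summit.CriticalPhenomena.PercolationContinuityZ3.Theorems

namespace FK

open SimpleGraph Literature.Probability.LatticeModels Literature.Probability.Percolation
open scoped Classical

variable {V : Type*} [Fintype V]

section OrAttSeriesSame

variable {E₁ E₂ : Finset (Sym2 V)} {V₁ V₂ : Set V} {s m t : V}

/-- Bookkeeping: six real numbers, one side grouped. [folklore] -/
private theorem six_le' {R₁ F₁ R₂ F₂ R₃ F₃ : ℝ} (h₁ : R₁ + R₂ + R₃ ≤ 0) (h₂ : F₁ ≤ 0) (h₃ : F₂ ≤ 0) (h₄ : F₃ ≤ 0) :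
    R₁ + F₁ + (R₂ + F₂) + (R₃ + F₃) ≤ 0 := by linarith

/-- Bookkeeping: six real numbers, the other side grouped. [folklore] -/
private theorem six_le'' {R₁ F₁ R₂ F₂ R₃ F₃ : ℝ} (h₁ : R₁ ≤ 0) (h₂ : R₂ ≤ 0) (h₃ : R₃ ≤ 0) (h₄ : F₁ + F₂ + F₃ ≤ 0) :
    R₁ + F₁ + (R₂ + F₂) + (R₃ + F₃) ≤ 0 := by linarith

/-- Bookkeeping: the `0/1`-weighted triple at a fixed outer configuration. [folklore] -/
private theorem ite_triple_le (c : Prop) [Decidable c] {A₁ B₁ A₂ B₂ A₃ B₃ : ℝ} (h₁ : A₁ + A₂ + A₃ ≤ 0) (h₂ : B₁ ≤ 0)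
    (h₃ : B₂ + B₃ = 0) :
    (if c then (1 : ℝ) else 0) * A₁ + (if c then (0 : ℝ) else 1) * B₁ +
      ((if c then (1 : ℝ) else 0) * A₂ + (if c then (0 : ℝ) else 1) * B₂) +
      ((if c then (1 : ℝ) else 0) * A₃ + (if c then (0 : ℝ) else 1) * B₃) ≤ 0 := by
  split_ifs <;> linarith

/-- **`O` ACROSS A SERIES JUNCTION, `y, z` ON SIDE 1** (abstract form, ANTITONE weights).  Inputs: on side 1 the three drifts of `O(N₁; y, z; C₁)`
with the virtual root `sm` (the induction hypothesis) and the rootless AND-contracted drift `(yzC₁ | C₁)`; on side 2 the U-drift `(C₂ | C₂)` with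
root `mt`.  Output: the three drifts of `O(N₁ ∪ N₂; y, z; C₁ ∪ C₂)` with root `st` add up to `≤ 0`.
[cite: Grimmett2006, §3.8 Thm. (3.90) (pp. 61–62)] -/
theorem orAttW_series_same₁_nonpos (h₁ : ∀ e ∈ (↑E₁ : Set (Sym2 V)), ∀ z ∈ e, z ∈ V₁)
    (h₂ : ∀ e ∈ (↑E₂ : Set (Sym2 V)), ∀ z ∈ e, z ∈ V₂) (hS : V₁ ∩ V₂ ⊆ {m}) (hsV₂ : s ∉ V₂) (htV₁ : t ∉ V₁)
    (hsm : s ≠ m) (htm : t ≠ m) (hst : s ≠ t)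
    {N₁ C₁ N₂ C₂ : Finset (Sym2 V)} {y z : Sym2 V} (hd : Disjoint N₁ N₂) (hN₁ : N₁ ⊆ E₁) (hC₁ : C₁ ⊆ E₁) (hy : y ∈ E₁) (hz : z ∈ E₁)
    (hN₂ : N₂ ⊆ E₂) (hC₂ : C₂ ⊆ E₂)
    (hO₁ : ∀ w' : ℕ → ℝ, (∀ n : ℕ, w' (n + 1) ≤ w' n) → ∀ h' : Finset (Sym2 V) → ℝ,
      (∀ ⦃A B : Finset (Sym2 V)⦄, A ⊆ B → B ⊆ N₁ → h' A ≤ h' B) →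
      ∑ γ ∈ N₁.powerset, (w' (clusterCount (↑(insert s(s, m) (γ ∪ insert y (insert z C₁))) : BondConfig V) ∅ +
          clusterCount (↑(N₁ \ γ ∪ C₁) : BondConfig V) ∅) -
        w' (clusterCount (↑(insert s(s, m) (N₁ \ γ ∪ insert y (insert z C₁))) : BondConfig V) ∅ +
          clusterCount (↑(γ ∪ C₁) : BondConfig V) ∅)) * h' γ +
      ∑ γ ∈ N₁.powerset, (w' (clusterCount (↑(insert s(s, m) (γ ∪ insert z C₁)) : BondConfig V) ∅ +
          clusterCount (↑(N₁ \ γ ∪ insert y C₁) : BondConfig V) ∅) -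
        w' (clusterCount (↑(insert s(s, m) (N₁ \ γ ∪ insert z C₁)) : BondConfig V) ∅ +
          clusterCount (↑(γ ∪ insert y C₁) : BondConfig V) ∅)) * h' γ +
      ∑ γ ∈ N₁.powerset, (w' (clusterCount (↑(insert s(s, m) (γ ∪ insert y C₁)) : BondConfig V) ∅ +
          clusterCount (↑(N₁ \ γ ∪ insert z C₁) : BondConfig V) ∅) -
        w' (clusterCount (↑(insert s(s, m) (N₁ \ γ ∪ insert y C₁)) : BondConfig V) ∅ +
          clusterCount (↑(γ ∪ insert z C₁) : BondConfig V) ∅)) * h' γ ≤ 0)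
    (hR₁ : ∀ w' : ℕ → ℝ, (∀ n : ℕ, w' (n + 1) ≤ w' n) → ∀ h' : Finset (Sym2 V) → ℝ,
      (∀ ⦃A B : Finset (Sym2 V)⦄, A ⊆ B → B ⊆ N₁ → h' A ≤ h' B) →
      ∑ γ ∈ N₁.powerset, (w' (clusterCount (↑(γ ∪ insert y (insert z C₁)) : BondConfig V) ∅ +
          clusterCount (↑(N₁ \ γ ∪ C₁) : BondConfig V) ∅) -
        w' (clusterCount (↑(N₁ \ γ ∪ insert y (insert z C₁)) : BondConfig V) ∅ + clusterCount (↑(γ ∪ C₁) : BondConfig V) ∅)) * h' γ ≤ 0)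
    (hU₂ : ∀ w' : ℕ → ℝ, (∀ n : ℕ, w' (n + 1) ≤ w' n) → ∀ h' : Finset (Sym2 V) → ℝ,
      (∀ ⦃A B : Finset (Sym2 V)⦄, A ⊆ B → B ⊆ N₂ → h' A ≤ h' B) →
      ∑ γ ∈ N₂.powerset, (w' (clusterCount (↑(insert s(m, t) (γ ∪ C₂)) : BondConfig V) ∅ + clusterCount (↑(N₂ \ γ ∪ C₂) : BondConfig V) ∅) -
        w' (clusterCount (↑(insert s(m, t) (N₂ \ γ ∪ C₂)) : BondConfig V) ∅ + clusterCount (↑(γ ∪ C₂) : BondConfig V) ∅)) * h' γ ≤ 0)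
    {w : ℕ → ℝ} (hw : ∀ n : ℕ, w (n + 1) ≤ w n)
    {g : Finset (Sym2 V) → ℝ} (hmono : ∀ ⦃A B : Finset (Sym2 V)⦄, A ⊆ B → B ⊆ N₁ ∪ N₂ → g A ≤ g B) :
    ∑ γ ∈ (N₁ ∪ N₂).powerset,
        (w (clusterCount (↑(insert s(s, t) (γ ∪ (insert y (insert z C₁) ∪ C₂))) : BondConfig V) ∅ +
              clusterCount (↑((N₁ ∪ N₂) \ γ ∪ (C₁ ∪ C₂)) : BondConfig V) ∅) -
          w (clusterCount (↑(insert s(s, t) ((N₁ ∪ N₂) \ γ ∪ (insert y (insert z C₁) ∪ C₂))) : BondConfig V) ∅ +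
              clusterCount (↑(γ ∪ (C₁ ∪ C₂)) : BondConfig V) ∅)) * g γ +
      ∑ γ ∈ (N₁ ∪ N₂).powerset,
        (w (clusterCount (↑(insert s(s, t) (γ ∪ (insert z C₁ ∪ C₂))) : BondConfig V) ∅ +
              clusterCount (↑((N₁ ∪ N₂) \ γ ∪ (insert y C₁ ∪ C₂)) : BondConfig V) ∅) -
          w (clusterCount (↑(insert s(s, t) ((N₁ ∪ N₂) \ γ ∪ (insert z C₁ ∪ C₂))) : BondConfig V) ∅ +
              clusterCount (↑(γ ∪ (insert y C₁ ∪ C₂)) : BondConfig V) ∅)) * g γ +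
      ∑ γ ∈ (N₁ ∪ N₂).powerset,
        (w (clusterCount (↑(insert s(s, t) (γ ∪ (insert y C₁ ∪ C₂))) : BondConfig V) ∅ +
              clusterCount (↑((N₁ ∪ N₂) \ γ ∪ (insert z C₁ ∪ C₂)) : BondConfig V) ∅) -
          w (clusterCount (↑(insert s(s, t) ((N₁ ∪ N₂) \ γ ∪ (insert y C₁ ∪ C₂))) : BondConfig V) ∅ +
              clusterCount (↑(γ ∪ (insert z C₁ ∪ C₂)) : BondConfig V) ∅)) * g γ ≤ 0 := by
  have hyzC₁ : insert y (insert z C₁) ⊆ E₁ := Finset.insert_subset hy (Finset.insert_subset hz hC₁)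
  have hyC₁ : insert y C₁ ⊆ E₁ := Finset.insert_subset hy hC₁
  have hzC₁ : insert z C₁ ⊆ E₁ := Finset.insert_subset hz hC₁
  have key₁ := andGenW_series_eq (fun k => w (k - (2 * Fintype.card V + 1))) h₁ h₂ hS hsV₂ htV₁ hsm htm hst hd hN₁ hyzC₁ hC₁
    hN₂ hC₂ hC₂ g
  have key₂ := andGenW_series_eq (fun k => w (k - (2 * Fintype.card V + 1))) h₁ h₂ hS hsV₂ htV₁ hsm htm hst hd hN₁ hzC₁ hyC₁
    hN₂ hC₂ hC₂ g
  have key₃ := andGenW_series_eq (fun k => w (k - (2 * Fintype.card V + 1))) h₁ h₂ hS hsV₂ htV₁ hsm htm hst hd hN₁ hyC₁ hzC₁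
    hN₂ hC₂ hC₂ g
  simp only [Nat.add_sub_cancel] at key₁ key₂ key₃
  rw [key₁, key₂, key₃]
  have sec₁ : ∀ γ₂ ∈ N₂.powerset, ∀ ⦃A B : Finset (Sym2 V)⦄, A ⊆ B → B ⊆ N₁ → g (A ∪ γ₂) ≤ g (B ∪ γ₂) := by
    intro γ₂ hγ₂ A B hAB hB
    rw [Finset.mem_powerset] at hγ₂
    exact hmono (Finset.union_subset_union hAB le_rfl) (Finset.union_subset_union hB hγ₂)
  have sec₂ : ∀ γ₁ ∈ N₁.powerset, ∀ ⦃A B : Finset (Sym2 V)⦄, A ⊆ B → B ⊆ N₂ → g (γ₁ ∪ A) ≤ g (γ₁ ∪ B) := by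
    intro γ₁ hγ₁ A B hAB hB
    rw [Finset.mem_powerset] at hγ₁
    exact hmono (Finset.union_subset_union le_rfl hAB) (Finset.union_subset_union hγ₁ hB)
  have shift : ∀ c : ℕ, ∀ n : ℕ, w (n + 1 + c - (2 * Fintype.card V + 1)) ≤ w (n + c - (2 * Fintype.card V + 1)) := fun c n => by
    have := antitoneW_sub hw (2 * Fintype.card V + 1) (n + c)
    rw [Nat.add_right_comm n 1 c]
    exact this
  -- a far-side term: `0/1` coefficient times the U-drift of side 2 (rooted), the rootless companion vanishes identically
  have far : ∀ (A' C' : Finset (Sym2 V)), ∑ γ₁ ∈ N₁.powerset,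
      ((if (openGraph (↑(γ₁ ∪ A') : BondConfig V)).Reachable s m then 1 else 0) *
          ∑ γ₂ ∈ N₂.powerset,
            (w (clusterCount (↑(insert s(m, t) (γ₂ ∪ C₂)) : BondConfig V) ∅ + clusterCount (↑(N₂ \ γ₂ ∪ C₂) : BondConfig V) ∅ +
                  (clusterCount (↑(γ₁ ∪ A') : BondConfig V) ∅ + clusterCount (↑(N₁ \ γ₁ ∪ C') : BondConfig V) ∅ + 1) -
                  (2 * Fintype.card V + 1)) -
              w (clusterCount (↑(insert s(m, t) (N₂ \ γ₂ ∪ C₂)) : BondConfig V) ∅ + clusterCount (↑(γ₂ ∪ C₂) : BondConfig V) ∅ +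
                  (clusterCount (↑(γ₁ ∪ A') : BondConfig V) ∅ + clusterCount (↑(N₁ \ γ₁ ∪ C') : BondConfig V) ∅ + 1) -
                  (2 * Fintype.card V + 1))) * g (γ₁ ∪ γ₂) +
        (if (openGraph (↑(γ₁ ∪ A') : BondConfig V)).Reachable s m then 0 else 1) *
          ∑ γ₂ ∈ N₂.powerset,
            (w (clusterCount (↑(γ₂ ∪ C₂) : BondConfig V) ∅ + clusterCount (↑(N₂ \ γ₂ ∪ C₂) : BondConfig V) ∅ +
                  (clusterCount (↑(γ₁ ∪ A') : BondConfig V) ∅ + clusterCount (↑(N₁ \ γ₁ ∪ C') : BondConfig V) ∅) -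
                  (2 * Fintype.card V + 1)) -
              w (clusterCount (↑(N₂ \ γ₂ ∪ C₂) : BondConfig V) ∅ + clusterCount (↑(γ₂ ∪ C₂) : BondConfig V) ∅ +
                  (clusterCount (↑(γ₁ ∪ A') : BondConfig V) ∅ + clusterCount (↑(N₁ \ γ₁ ∪ C') : BondConfig V) ∅) -
                  (2 * Fintype.card V + 1))) * g (γ₁ ∪ γ₂)) ≤ 0 := by
    intro A' C'
    refine Finset.sum_nonpos fun γ₁ hγ₁ => ?_
    set c₁ := clusterCount (↑(γ₁ ∪ A') : BondConfig V) ∅ + clusterCount (↑(N₁ \ γ₁ ∪ C') : BondConfig V) ∅ with hc₁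
    have i₁ := hU₂ (fun n => w (n + (c₁ + 1) - (2 * Fintype.card V + 1))) (shift (c₁ + 1)) (fun γ₂ => g (γ₁ ∪ γ₂)) (sec₂ γ₁ hγ₁)
    have z₀ := andGenW_rootless_self (fun n => w (n + c₁ - (2 * Fintype.card V + 1))) N₂ C₂ (fun γ₂ => g (γ₁ ∪ γ₂))
    rw [z₀, mul_zero, add_zero]
    refine mul_nonpos_of_nonneg_of_nonpos ?_ i₁
    split_ifs <;> norm_num
  refine six_le' ?_ (far _ _) (far _ _) (far _ _)
  -- the near side: `O₁` with the virtual root `sm` (rooted), the AND-contracted rootless drift, and a cancelling rootless pair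
  rw [← Finset.sum_add_distrib, ← Finset.sum_add_distrib]
  refine Finset.sum_nonpos fun γ₂ hγ₂ => ?_
  set c₂ := clusterCount (↑(N₂ \ γ₂ ∪ C₂) : BondConfig V) ∅ + clusterCount (↑(γ₂ ∪ C₂) : BondConfig V) ∅ with hc₂
  refine ite_triple_le _ ?_ ?_ ?_
  · exact hO₁ (fun n => w (n + (c₂ + 1) - (2 * Fintype.card V + 1))) (shift (c₂ + 1)) (fun γ₁ => g (γ₁ ∪ γ₂)) (sec₁ γ₂ hγ₂)
  · exact hR₁ (fun n => w (n + c₂ - (2 * Fintype.card V + 1))) (shift c₂) (fun γ₁ => g (γ₁ ∪ γ₂)) (sec₁ γ₂ hγ₂)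
  · exact twoSidedW_swap (fun n => w (n + c₂ - (2 * Fintype.card V + 1))) N₁ (insert z C₁) (insert y C₁) (fun γ₁ => g (γ₁ ∪ γ₂))

/-- **`O` ACROSS A SERIES JUNCTION, `y, z` ON SIDE 2** (abstract form, ANTITONE weights; mirror image of
`FK.orAttW_series_same₁_nonpos`). [cite: Grimmett2006, §3.8 Thm. (3.90) (pp. 61–62)] -/
theorem orAttW_series_same₂_nonpos (h₁ : ∀ e ∈ (↑E₁ : Set (Sym2 V)), ∀ z ∈ e, z ∈ V₁)
    (h₂ : ∀ e ∈ (↑E₂ : Set (Sym2 V)), ∀ z ∈ e, z ∈ V₂) (hS : V₁ ∩ V₂ ⊆ {m}) (hsV₂ : s ∉ V₂) (htV₁ : t ∉ V₁)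
    (hsm : s ≠ m) (htm : t ≠ m) (hst : s ≠ t)
    {N₁ C₁ N₂ C₂ : Finset (Sym2 V)} {y z : Sym2 V} (hd : Disjoint N₁ N₂) (hN₁ : N₁ ⊆ E₁) (hC₁ : C₁ ⊆ E₁)
    (hN₂ : N₂ ⊆ E₂) (hC₂ : C₂ ⊆ E₂) (hy : y ∈ E₂) (hz : z ∈ E₂)
    (hU₁ : ∀ w' : ℕ → ℝ, (∀ n : ℕ, w' (n + 1) ≤ w' n) → ∀ h' : Finset (Sym2 V) → ℝ,
      (∀ ⦃A B : Finset (Sym2 V)⦄, A ⊆ B → B ⊆ N₁ → h' A ≤ h' B) →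
      ∑ γ ∈ N₁.powerset, (w' (clusterCount (↑(insert s(s, m) (γ ∪ C₁)) : BondConfig V) ∅ + clusterCount (↑(N₁ \ γ ∪ C₁) : BondConfig V) ∅) -
        w' (clusterCount (↑(insert s(s, m) (N₁ \ γ ∪ C₁)) : BondConfig V) ∅ + clusterCount (↑(γ ∪ C₁) : BondConfig V) ∅)) * h' γ ≤ 0)
    (hO₂ : ∀ w' : ℕ → ℝ, (∀ n : ℕ, w' (n + 1) ≤ w' n) → ∀ h' : Finset (Sym2 V) → ℝ,
      (∀ ⦃A B : Finset (Sym2 V)⦄, A ⊆ B → B ⊆ N₂ → h' A ≤ h' B) →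
      ∑ γ ∈ N₂.powerset, (w' (clusterCount (↑(insert s(m, t) (γ ∪ insert y (insert z C₂))) : BondConfig V) ∅ +
          clusterCount (↑(N₂ \ γ ∪ C₂) : BondConfig V) ∅) -
        w' (clusterCount (↑(insert s(m, t) (N₂ \ γ ∪ insert y (insert z C₂))) : BondConfig V) ∅ +
          clusterCount (↑(γ ∪ C₂) : BondConfig V) ∅)) * h' γ +
      ∑ γ ∈ N₂.powerset, (w' (clusterCount (↑(insert s(m, t) (γ ∪ insert z C₂)) : BondConfig V) ∅ +
          clusterCount (↑(N₂ \ γ ∪ insert y C₂) : BondConfig V) ∅) -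
        w' (clusterCount (↑(insert s(m, t) (N₂ \ γ ∪ insert z C₂)) : BondConfig V) ∅ +
          clusterCount (↑(γ ∪ insert y C₂) : BondConfig V) ∅)) * h' γ +
      ∑ γ ∈ N₂.powerset, (w' (clusterCount (↑(insert s(m, t) (γ ∪ insert y C₂)) : BondConfig V) ∅ +
          clusterCount (↑(N₂ \ γ ∪ insert z C₂) : BondConfig V) ∅) -
        w' (clusterCount (↑(insert s(m, t) (N₂ \ γ ∪ insert y C₂)) : BondConfig V) ∅ +
          clusterCount (↑(γ ∪ insert z C₂) : BondConfig V) ∅)) * h' γ ≤ 0)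
    (hR₂ : ∀ w' : ℕ → ℝ, (∀ n : ℕ, w' (n + 1) ≤ w' n) → ∀ h' : Finset (Sym2 V) → ℝ,
      (∀ ⦃A B : Finset (Sym2 V)⦄, A ⊆ B → B ⊆ N₂ → h' A ≤ h' B) →
      ∑ γ ∈ N₂.powerset, (w' (clusterCount (↑(γ ∪ insert y (insert z C₂)) : BondConfig V) ∅ +
          clusterCount (↑(N₂ \ γ ∪ C₂) : BondConfig V) ∅) -
        w' (clusterCount (↑(N₂ \ γ ∪ insert y (insert z C₂)) : BondConfig V) ∅ + clusterCount (↑(γ ∪ C₂) : BondConfig V) ∅)) * h' γ ≤ 0)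
    {w : ℕ → ℝ} (hw : ∀ n : ℕ, w (n + 1) ≤ w n)
    {g : Finset (Sym2 V) → ℝ} (hmono : ∀ ⦃A B : Finset (Sym2 V)⦄, A ⊆ B → B ⊆ N₁ ∪ N₂ → g A ≤ g B) :
    ∑ γ ∈ (N₁ ∪ N₂).powerset,
        (w (clusterCount (↑(insert s(s, t) (γ ∪ (C₁ ∪ insert y (insert z C₂)))) : BondConfig V) ∅ +
              clusterCount (↑((N₁ ∪ N₂) \ γ ∪ (C₁ ∪ C₂)) : BondConfig V) ∅) -
          w (clusterCount (↑(insert s(s, t) ((N₁ ∪ N₂) \ γ ∪ (C₁ ∪ insert y (insert z C₂)))) : BondConfig V) ∅ +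
              clusterCount (↑(γ ∪ (C₁ ∪ C₂)) : BondConfig V) ∅)) * g γ +
      ∑ γ ∈ (N₁ ∪ N₂).powerset,
        (w (clusterCount (↑(insert s(s, t) (γ ∪ (C₁ ∪ insert z C₂))) : BondConfig V) ∅ +
              clusterCount (↑((N₁ ∪ N₂) \ γ ∪ (C₁ ∪ insert y C₂)) : BondConfig V) ∅) -
          w (clusterCount (↑(insert s(s, t) ((N₁ ∪ N₂) \ γ ∪ (C₁ ∪ insert z C₂))) : BondConfig V) ∅ +
              clusterCount (↑(γ ∪ (C₁ ∪ insert y C₂)) : BondConfig V) ∅)) * g γ +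
      ∑ γ ∈ (N₁ ∪ N₂).powerset,
        (w (clusterCount (↑(insert s(s, t) (γ ∪ (C₁ ∪ insert y C₂))) : BondConfig V) ∅ +
              clusterCount (↑((N₁ ∪ N₂) \ γ ∪ (C₁ ∪ insert z C₂)) : BondConfig V) ∅) -
          w (clusterCount (↑(insert s(s, t) ((N₁ ∪ N₂) \ γ ∪ (C₁ ∪ insert y C₂))) : BondConfig V) ∅ +
              clusterCount (↑(γ ∪ (C₁ ∪ insert z C₂)) : BondConfig V) ∅)) * g γ ≤ 0 := by
  have hyzC₂ : insert y (insert z C₂) ⊆ E₂ := Finset.insert_subset hy (Finset.insert_subset hz hC₂)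
  have hyC₂ : insert y C₂ ⊆ E₂ := Finset.insert_subset hy hC₂
  have hzC₂ : insert z C₂ ⊆ E₂ := Finset.insert_subset hz hC₂
  have key₁ := andGenW_series_eq (fun k => w (k - (2 * Fintype.card V + 1))) h₁ h₂ hS hsV₂ htV₁ hsm htm hst hd hN₁ hC₁ hC₁
    hN₂ hyzC₂ hC₂ g
  have key₂ := andGenW_series_eq (fun k => w (k - (2 * Fintype.card V + 1))) h₁ h₂ hS hsV₂ htV₁ hsm htm hst hd hN₁ hC₁ hC₁
    hN₂ hzC₂ hyC₂ g
  have key₃ := andGenW_series_eq (fun k => w (k - (2 * Fintype.card V + 1))) h₁ h₂ hS hsV₂ htV₁ hsm htm hst hd hN₁ hC₁ hC₁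
    hN₂ hyC₂ hzC₂ g
  simp only [Nat.add_sub_cancel] at key₁ key₂ key₃
  rw [key₁, key₂, key₃]
  have sec₁ : ∀ γ₂ ∈ N₂.powerset, ∀ ⦃A B : Finset (Sym2 V)⦄, A ⊆ B → B ⊆ N₁ → g (A ∪ γ₂) ≤ g (B ∪ γ₂) := by
    intro γ₂ hγ₂ A B hAB hB
    rw [Finset.mem_powerset] at hγ₂
    exact hmono (Finset.union_subset_union hAB le_rfl) (Finset.union_subset_union hB hγ₂)
  have sec₂ : ∀ γ₁ ∈ N₁.powerset, ∀ ⦃A B : Finset (Sym2 V)⦄, A ⊆ B → B ⊆ N₂ → g (γ₁ ∪ A) ≤ g (γ₁ ∪ B) := by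
    intro γ₁ hγ₁ A B hAB hB
    rw [Finset.mem_powerset] at hγ₁
    exact hmono (Finset.union_subset_union le_rfl hAB) (Finset.union_subset_union hγ₁ hB)
  have shift : ∀ c : ℕ, ∀ n : ℕ, w (n + 1 + c - (2 * Fintype.card V + 1)) ≤ w (n + c - (2 * Fintype.card V + 1)) := fun c n => by
    have := antitoneW_sub hw (2 * Fintype.card V + 1) (n + c)
    rw [Nat.add_right_comm n 1 c]
    exact this
  -- a far-side term (side 1 here): `0/1` coefficient times the U-drift of side 1, the rootless companion vanishes identically
  have far : ∀ (A' C' : Finset (Sym2 V)), ∑ γ₂ ∈ N₂.powerset,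
      ((if (openGraph (↑(N₂ \ γ₂ ∪ A') : BondConfig V)).Reachable m t then 1 else 0) *
          ∑ γ₁ ∈ N₁.powerset,
            (w (clusterCount (↑(insert s(s, m) (γ₁ ∪ C₁)) : BondConfig V) ∅ + clusterCount (↑(N₁ \ γ₁ ∪ C₁) : BondConfig V) ∅ +
                  (clusterCount (↑(N₂ \ γ₂ ∪ A') : BondConfig V) ∅ + clusterCount (↑(γ₂ ∪ C') : BondConfig V) ∅ + 1) -
                  (2 * Fintype.card V + 1)) -
              w (clusterCount (↑(insert s(s, m) (N₁ \ γ₁ ∪ C₁)) : BondConfig V) ∅ + clusterCount (↑(γ₁ ∪ C₁) : BondConfig V) ∅ +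
                  (clusterCount (↑(N₂ \ γ₂ ∪ A') : BondConfig V) ∅ + clusterCount (↑(γ₂ ∪ C') : BondConfig V) ∅ + 1) -
                  (2 * Fintype.card V + 1))) * g (γ₁ ∪ γ₂) +
        (if (openGraph (↑(N₂ \ γ₂ ∪ A') : BondConfig V)).Reachable m t then 0 else 1) *
          ∑ γ₁ ∈ N₁.powerset,
            (w (clusterCount (↑(γ₁ ∪ C₁) : BondConfig V) ∅ + clusterCount (↑(N₁ \ γ₁ ∪ C₁) : BondConfig V) ∅ +
                  (clusterCount (↑(N₂ \ γ₂ ∪ A') : BondConfig V) ∅ + clusterCount (↑(γ₂ ∪ C') : BondConfig V) ∅) -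
                  (2 * Fintype.card V + 1)) -
              w (clusterCount (↑(N₁ \ γ₁ ∪ C₁) : BondConfig V) ∅ + clusterCount (↑(γ₁ ∪ C₁) : BondConfig V) ∅ +
                  (clusterCount (↑(N₂ \ γ₂ ∪ A') : BondConfig V) ∅ + clusterCount (↑(γ₂ ∪ C') : BondConfig V) ∅) -
                  (2 * Fintype.card V + 1))) * g (γ₁ ∪ γ₂)) ≤ 0 := by
    intro A' C'
    refine Finset.sum_nonpos fun γ₂ hγ₂ => ?_
    set c₂ := clusterCount (↑(N₂ \ γ₂ ∪ A') : BondConfig V) ∅ + clusterCount (↑(γ₂ ∪ C') : BondConfig V) ∅ with hc₂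
    have i₁ := hU₁ (fun n => w (n + (c₂ + 1) - (2 * Fintype.card V + 1))) (shift (c₂ + 1)) (fun γ₁ => g (γ₁ ∪ γ₂)) (sec₁ γ₂ hγ₂)
    have z₀ := andGenW_rootless_self (fun n => w (n + c₂ - (2 * Fintype.card V + 1))) N₁ C₁ (fun γ₁ => g (γ₁ ∪ γ₂))
    rw [z₀, mul_zero, add_zero]
    refine mul_nonpos_of_nonneg_of_nonpos ?_ i₁
    split_ifs <;> norm_num
  refine six_le'' (far _ _) (far _ _) (far _ _) ?_
  rw [← Finset.sum_add_distrib, ← Finset.sum_add_distrib]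
  refine Finset.sum_nonpos fun γ₁ hγ₁ => ?_
  set c₁ := clusterCount (↑(γ₁ ∪ C₁) : BondConfig V) ∅ + clusterCount (↑(N₁ \ γ₁ ∪ C₁) : BondConfig V) ∅ with hc₁
  refine ite_triple_le _ ?_ ?_ ?_
  · exact hO₂ (fun n => w (n + (c₁ + 1) - (2 * Fintype.card V + 1))) (shift (c₁ + 1)) (fun γ₂ => g (γ₁ ∪ γ₂)) (sec₂ γ₁ hγ₁)
  · exact hR₂ (fun n => w (n + c₁ - (2 * Fintype.card V + 1))) (shift c₁) (fun γ₂ => g (γ₁ ∪ γ₂)) (sec₂ γ₁ hγ₁)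
  · exact twoSidedW_swap (fun n => w (n + c₁ - (2 * Fintype.card V + 1))) N₂ (insert z C₂) (insert y C₂) (fun γ₂ => g (γ₁ ∪ γ₂))

end OrAttSeriesSame

end FK

end Summit.CriticalPhenomena.PercolationContinuityZ3.Theorems

end
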